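import Literature.NumberTheory.EllipticCurves.PlusMinusPAdicLFunctionProofs
import Literature.NumberTheory.EllipticCurves.PAdicLFunctionMinusIntegralityProofs
import Literature.NumberTheory.EllipticCurves.PAdicLFunctionMinusDistributionProofs
import HarnessLib

/-!
# The Mazur–Tate modular element on the QUADRATIC branch `η = ω^{(p−1)/2}`:
# `θ_n(f, η, T) = ∑_{w ∈ μ_{p−1}} ∑_{s mod pⁿ} η(w) [wγ^s/p^{n+1}]^δ_f (1+T)^s` (definitions + the
# branch-symbol API), file 1 of 5 towards the EXISTENCE of Kobayashi's `L_p⁻(V, η, X)` (Thm. 3.2)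

HONEST FRAMING (cell `bsd-potss`, run/shared/lean/pub/bsd-potss/, FULL-BSD rank ≤ 1 programme
tranche 1b, human ruling D-0036; seat `bsd-potss-ctrl` = "signed control along the quadratic branch"):
the programme's target of record is FULL BSD for every analytic-rank ≤ 1 curve over `ℚ`; this seat's
object is the quadratic (`η = ω^{(p−1)/2}`) branch of Kobayashi's signed theory for the good
`a_p = 0` twin `V` of an additive potentially supersingular curve `W = V ⊗ η` (classes Gss2 / O5 `e = 2`,
O10-PS). THIS FILE: THREE DEFINITIONS with bodies (`teichSign`, `branchSymbol`,
`quadraticBranchMazurTateElement`) + PROVED lemmas about them; NOTHING about `BSD(W, p)`, (C1_η), (C2_η-GZ) or (C3_η) of any pair is claimed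
or moved; no named Literature fact is introduced; axioms standard.

## What and why

The tree PROVES Pollack's/Kobayashi's `L_p^±(E, X)` exist on the TRIVIAL branch
(`pollack_exists_plusMinusPAdicLFunction_holds`, algebraic reconstruction from the Mazur–Tate elements
`mazurTateElement f p n`), but on the quadratic branch the existence of Kobayashi's `L_p⁻(V, η, X)`
(Invent. Math. 152 (2003) Thm. 3.2 with (3.5), (3.7)) — pinned by the tree's predicate
`IsQuadraticBranchMinusLFunction f p ϖ L` (`QuadraticBranchOddStrictSelmer.lean`) and UNIQUE up to
`ℤ_p^×` (`QuadraticBranchMinusLFunctionUnique.lean`) — was only DISPLAYED as a hypothesis (the binder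
`hdata` of `X12/ClassClosureO10Refined.lean`; the docstring of the predicate: "exists by Kobayashi's
Thm. 3.2 … NOT vendored here"). Every consumer of (C1_η) ∧ (C2_η-GZ) ∧ (C3_η) binds such an `L`.
This series of files PROVES the existence by running the trivial-branch reconstruction on the
`η`-component: here the objects —
* `teichSign p w = η(w) = w^{(p−1)/2} = ±1` on the Teichmüller representatives `w ∈ μ_{p−1}(ℤ_p)`
  (`cast_teichSign_eq_pow`), multiplicative, `∑_w η(w) = 0`;
* `branchSymbol p f r = [r]^δ_f` — `[r]⁺_f` for `p ≡ 1 (mod 4)`, `[r]⁻_f` for `p ≡ 3 (mod 4)`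
  (the parity `δ = η(−1)`, exactly the `if Even (p / 2)` of the tree's predicates) — with its Hecke
  relation at `a_p = 0`, translation invariance and `p`-integrality (both parities are tree theorems);
* `quadraticBranchMazurTateElement p f n = θ_n(f, η, T) ∈ ℚ[T]`, the `η`-twisted twin of
  `mazurTateElement f p n` (Mazur–Tate–Teitelbaum §I.13 "`L_p(f, χ, T)` for a tame character `χ`";
  Pollack Def. 6.15), and the fibre/orbit sums of the Hecke relation needed for its three-term
  relation (file 2).

References: [Kobayashi2003] Thm. 3.2, (3.4)–(3.7) (p. 7), §3 (pp. 5–6); [Pollack2003] Def. 6.15,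
Prop. 6.18, Thm. 5.6; [MazurTateTeitelbaum1986Invent] §I.4 (4.2), §I.8 (8.6), §I.10 (10.2), §I.13.
-/

noncomputable section

open scoped Classical MatrixGroups ModularForm

open CongruenceSubgroup Polynomial Literature.NumberTheory.EllipticCurves
  Literature.NumberTheory.EllipticCurves.ModularForms

namespace Summit.BirchSwinnertonDyer.Rank1Residual.Additive

/-! ## §0 Definitions: the quadratic sign on Teichmüller representatives, the branch symbol, the
twisted Mazur–Tate element -/

section Defs

variable (p : ℕ) [Fact p.Prime]

/-- **The quadratic character `η = ω^{(p−1)/2}` on the Teichmüller representatives** `w ∈ μ_{p−1}(ℤ_p)`: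
`η(w) = w^{(p−1)/2} = ±1`, recorded as the integer `1` or `−1` (`torsionOrder p = p − 1` for odd `p`).
This is the value at `w mod p^{n+1}` of every Dirichlet character of order `2pⁿ` modulo `p^{n+1}`
(`apply_toZModPow_rootsOfUnity_eq_teichSign` below). [cite: Kobayashi2003, §3 (p. 6: η : Δ → ℤ_p^×) and (3.5)]
[cite: MazurTateTeitelbaum1986Invent, §I.13] -/
def teichSign (w : rootsOfUnity (torsionOrder p) ℤ_[p]) : ℤ :=
  if ((w : ℤ_[p]ˣ) : ℤ_[p]) ^ (torsionOrder p / 2) = 1 then 1 else -1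

variable {N : ℕ} (f : CuspForm (Gamma0 N) 2)

/-- **The modular symbol of the parity of `η = ω^{(p−1)/2}`**: `[r]^δ_f = [r]⁺_f` (`ratPlusSymbol`)
if `p ≡ 1 (mod 4)` (`η` even) and `[r]⁻_f` (`ratMinusSymbol`) if `p ≡ 3 (mod 4)` (`η` odd) — the
symbol entering Kobayashi's (3.4)/(3.5) through Birch's formula (`Ω_E^δ`, `δ = η(−1)`), exactly as in
the tree's `IsQuadraticBranchPlusLFunction` / `IsQuadraticBranchMinusLFunction`.
[cite: Kobayashi2003, Thm. 3.2 and (3.4)–(3.5) (p. 7)] [cite: MazurTateTeitelbaum1986Invent, §I.8 (8.6)] -/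
def branchSymbol (r : ℚ) : ℚ :=
  if Even (p / 2) then ratPlusSymbol f r else ratMinusSymbol f r

/-- **The Mazur–Tate element on the quadratic branch** `θ_n(f, η, T) ∈ ℚ[T]`, `η = ω^{(p−1)/2}`:
`θ_n(f, η, T) = ∑_{w ∈ μ_{p−1}} ∑_{s mod pⁿ} η(w) [w γ^s / p^{n+1}]^δ_f (1 + T)^s`
(`γ = cyclotomicGenerator p = 1 + p`, `s` represented in `[0, pⁿ)`), i.e. the `η`-component of the
modular element `∑_{a ∈ (ℤ/p^{n+1})^×} [a/p^{n+1}]^δ σ_a` under `(ℤ/p^{n+1})^× = μ_{p−1} × Γ/Γ^{pⁿ}`,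
`σ_{wγ^s} ↦ η(w)(1+T)^s` — the twin of the tree's `mazurTateElement f p n` (trivial branch). Its value
at `T = ψ(γ) − 1` for `ψ` of order `2pⁿ` is the Birch sum `∑_a ψ(a)[a/p^{n+1}]^δ_f` of Kobayashi's
(3.4)/(3.5). Written with the tree's level `n + cyclotomicExponent p` (`= n + 1` for odd `p`).
[cite: Kobayashi2003, Thm. 3.2 and (3.4)–(3.5) (p. 7)] [cite: MazurTateTeitelbaum1986Invent, §I.13]
[cite: Pollack2003, Def. 6.15] -/
def quadraticBranchMazurTateElement (n : ℕ) : ℚ[X] :=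
  ∑ᶠ w : rootsOfUnity (torsionOrder p) ℤ_[p], ∑ s : ZMod (p ^ n),
    C ((teichSign p w : ℚ) * branchSymbol p f
        (((PadicInt.toZModPow (n + cyclotomicExponent p) ((w : ℤ_[p]ˣ) : ℤ_[p]) *
              (cyclotomicGenerator p : ZMod (p ^ (n + cyclotomicExponent p))) ^ s.val).val : ℚ) /
          (p : ℚ) ^ (n + cyclotomicExponent p))) *
      (X + 1) ^ s.val

end Defs

/-! ## §1 The sign `η(w)` -/

section Sign

variable (p : ℕ) [hp : Fact p.Prime]

/-- `η(w) = ±1`. [folklore] -/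
theorem teichSign_eq_one_or (w : rootsOfUnity (torsionOrder p) ℤ_[p]) :
    teichSign p w = 1 ∨ teichSign p w = -1 := by
  unfold teichSign; split_ifs <;> simp

/-- `η(w)² = 1` in any ring. [folklore] -/
theorem teichSign_mul_self {R : Type*} [CommRing R] (w : rootsOfUnity (torsionOrder p) ℤ_[p]) :
    ((teichSign p w : ℤ) : R) * ((teichSign p w : ℤ) : R) = 1 := by
  rcases teichSign_eq_one_or p w with h | h <;> simp [h]

/-- For odd `p`, `w^{(p−1)/2}` is `1` or `−1` for every `w ∈ μ_{p−1}(ℤ_p)`. [folklore] -/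
theorem pow_torsionOrder_div_two_eq_or (hp2 : p ≠ 2) (w : rootsOfUnity (torsionOrder p) ℤ_[p]) :
    ((w : ℤ_[p]ˣ) : ℤ_[p]) ^ (torsionOrder p / 2) = 1 ∨
      ((w : ℤ_[p]ˣ) : ℤ_[p]) ^ (torsionOrder p / 2) = -1 := by
  have hτ : torsionOrder p = 2 * (torsionOrder p / 2) := by
    rw [torsionOrder_eq, if_neg hp2]
    rcases hp.out.eq_two_or_odd with h | h
    · exact absurd h hp2
    · omega
  have hsq : ((w : ℤ_[p]ˣ) : ℤ_[p]) ^ (torsionOrder p / 2) * ((w : ℤ_[p]ˣ) : ℤ_[p]) ^ (torsionOrder p / 2)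
      = 1 := by
    rw [← pow_two, ← pow_mul, mul_comm, ← hτ]
    exact rootsOfUnity_pow_torsionOrder p w
  exact mul_self_eq_one_iff.mp hsq

/-- `η(w)` read in `ℤ_p` IS `w^{(p−1)/2}` (odd `p`). [folklore] -/
theorem cast_teichSign_eq_pow (hp2 : p ≠ 2) (w : rootsOfUnity (torsionOrder p) ℤ_[p]) :
    ((teichSign p w : ℤ) : ℤ_[p]) = ((w : ℤ_[p]ˣ) : ℤ_[p]) ^ (torsionOrder p / 2) := by
  unfold teichSign
  rcases pow_torsionOrder_div_two_eq_or p hp2 w with h | h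
  · rw [if_pos h, h]; simp
  · have hne : ((w : ℤ_[p]ˣ) : ℤ_[p]) ^ (torsionOrder p / 2) ≠ 1 := by
      rw [h]
      intro h1
      have h2 : (2 : ℤ_[p]) = 0 := by linear_combination -h1
      have : (p : ℤ_[p]) ∣ 2 := by rw [h2]; exact dvd_zero _
      have h3 : (p : ℕ) ∣ 2 := by
        have := (PadicInt.norm_lt_one_iff_dvd (2 : ℤ_[p])).mpr ?_
        · exact_mod_cast (PadicInt.norm_int_lt_one_iff_dvd 2).mp (by exact_mod_cast this)
        · exact_mod_cast this
      exact hp2 ((Nat.prime_dvd_prime_iff_eq hp.out Nat.prime_two).mp h3)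
    rw [if_neg hne, h]; simp

/-- `η` is multiplicative on `μ_{p−1}(ℤ_p)` (odd `p`). [folklore] -/
theorem teichSign_mul (hp2 : p ≠ 2) (w w' : rootsOfUnity (torsionOrder p) ℤ_[p]) :
    teichSign p (w * w') = teichSign p w * teichSign p w' := by
  have h := cast_teichSign_eq_pow p hp2 (w * w')
  rw [Subgroup.coe_mul, Units.val_mul, mul_pow, ← cast_teichSign_eq_pow p hp2 w,
    ← cast_teichSign_eq_pow p hp2 w', ← Int.cast_mul] at h
  exact_mod_cast (Int.cast_injective (α := ℤ_[p])) h

/-- There is a Teichmüller representative with `η(w) = −1` (odd `p`): a primitive `(p−1)`-th root of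
unity `ξ ∈ ℤ_p` has `ξ^{(p−1)/2} ≠ 1`. [folklore] -/
theorem exists_teichSign_eq_neg_one (hp2 : p ≠ 2) :
    ∃ w : rootsOfUnity (torsionOrder p) ℤ_[p], teichSign p w = -1 := by
  haveI := neZero_torsionOrder p
  obtain ⟨ξ, hξ⟩ := exists_isPrimitiveRoot_torsionOrder p
  have hτpos : 0 < torsionOrder p := zero_lt_torsionOrder p
  have hτ2 : 2 ≤ torsionOrder p := by
    rw [torsionOrder_eq, if_neg hp2]
    have := hp.out.two_le
    rcases hp.out.eq_two_or_odd with h | h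
    · exact absurd h hp2
    · omega
  refine ⟨hξ.toRootsOfUnity, ?_⟩
  unfold teichSign
  rw [if_neg]
  intro h1
  have hval : ((hξ.toRootsOfUnity : ℤ_[p]ˣ) : ℤ_[p]) = ξ := by simp
  rw [hval] at h1
  have h2 := hξ.dvd_of_pow_eq_one _ h1
  have h3 : 0 < torsionOrder p / 2 := Nat.div_pos hτ2 two_pos
  have h4 := Nat.le_of_dvd h3 h2
  omega

/-- **`∑_{w ∈ μ_{p−1}} η(w) = 0`** (odd `p`): multiplication by a `w₀` with `η(w₀) = −1` permutes the
summands and flips their sign. [folklore] -/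
theorem sum_teichSign_eq_zero (hp2 : p ≠ 2) [Fintype (rootsOfUnity (torsionOrder p) ℤ_[p])] :
    ∑ w : rootsOfUnity (torsionOrder p) ℤ_[p], (teichSign p w : ℚ) = 0 := by
  obtain ⟨w₀, hw₀⟩ := exists_teichSign_eq_neg_one p hp2
  have h := Fintype.sum_equiv (Equiv.mulLeft w₀) (fun w ↦ (teichSign p (w₀ * w) : ℚ))
    (fun w ↦ (teichSign p w : ℚ)) (fun w ↦ rfl)
  have h2 : ∑ w : rootsOfUnity (torsionOrder p) ℤ_[p], (teichSign p (w₀ * w) : ℚ) =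
      -∑ w : rootsOfUnity (torsionOrder p) ℤ_[p], (teichSign p w : ℚ) := by
    rw [← Finset.sum_neg_distrib]
    refine Finset.sum_congr rfl fun w _ ↦ ?_
    rw [teichSign_mul p hp2, hw₀]; push_cast; ring
  linarith [h.symm.trans h2]

end Sign

/-! ## §2 The branch symbol: Hecke relation at `a_p = 0`, translation invariance, integrality -/

section Symbol

variable {N : ℕ} [NeZero N] {f : CuspForm (Gamma0 N) 2} {p : ℕ} [Fact p.Prime]

omit [Fact p.Prime] in
/-- `[r + n]^δ_f = [r]^δ_f`. [cite: MazurTateTeitelbaum1986Invent, §I.4 (4.2)] -/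
theorem branchSymbol_add_intCast (r : ℚ) (n : ℤ) :
    branchSymbol p f (r + n) = branchSymbol p f r := by
  unfold branchSymbol
  split_ifs
  · exact ratPlusSymbol_add_intCast_eq f r n
  · exact ratMinusSymbol_add_intCast f r n

/-- **The Hecke relation at `p` with `a_p = 0` for the branch symbol**:
`∑_{j<p} [(r + j)/p]^δ_f = −[p r]^δ_f`. [cite: MazurTateTeitelbaum1986Invent, §I.4 (4.2)] -/
theorem sum_range_branchSymbol_div_eq_neg (hf0 : IsNewform0 f) (hQ : coeffField f = ⊥)
    (hpN : ¬ p ∣ N) (hap : cuspCoeff f p = ((0 : ℤ) : ℂ)) (r : ℚ) :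
    ∑ j ∈ Finset.range p, branchSymbol p f ((r + j) / p) = -branchSymbol p f (p * r) := by
  have hp : p.Prime := Fact.out
  unfold branchSymbol
  split_ifs
  · have h := intCast_mul_ratPlusSymbol p hf0 hp hpN hap
      (fun r ↦ ratCast_ratPlusSymbol_holds hf0 hQ r) r
    rw [Int.cast_zero, zero_mul, Fin.sum_univ_eq_sum_range (fun j ↦ ratPlusSymbol f ((r + j) / p)) p]
      at h
    linarith
  · have h := intCast_mul_ratMinusSymbol p hf0 hp hpN hap
      (fun r ↦ ratCast_ratMinusSymbol f hf0 hQ r) r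
    rw [Int.cast_zero, zero_mul,
      Fin.sum_univ_eq_sum_range (fun j ↦ ratMinusSymbol f ((r + j) / p)) p] at h
    linarith

/-- **`p`-integrality of `[a/p^k]^δ_f`** for `p` odd, `p ∤ N`, `a_p = 0` (plus sign: the Eisenstein
number `a_p − p − 1 = −(p+1)` is a `p`-adic unit, `norm_ratPlusSymbol_div_pow_le_one`; minus sign:
`[r]⁻ ∈ ½ℤ`, `norm_ratMinusSymbol_le_one`). [cite: Pollack2003, Thm. 5.6] -/
theorem norm_branchSymbol_div_pow_le_one (hp2 : p ≠ 2) (hf0 : IsNewform0 f) (hQ : coeffField f = ⊥)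
    (hpN : ¬ p ∣ N) (hap : cuspCoeff f p = ((0 : ℤ) : ℂ)) (a k : ℕ) :
    ‖((branchSymbol p f ((a : ℚ) / (p : ℚ) ^ k) : ℚ) : ℚ_[p])‖ ≤ 1 := by
  unfold branchSymbol
  split_ifs
  · exact norm_ratPlusSymbol_div_pow_le_one hp2 hf0 hpN hap a k
  · exact norm_ratMinusSymbol_le_one f hp2 (cuspCoeff_im_eq_zero_of_coeffField_eq_bot hQ)
      (coprime_den_div_prime_pow hpN a k)

/-- **The fibre sum at `a_p = 0`** for the branch symbol: summing `[b/p^{L+1}]^δ_f` over the `p` lifts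
`b` of `a mod p^L` gives `−[p · a/p^L]^δ_f`. [cite: MazurTateTeitelbaum1986Invent, §I.10 Prop. (10.2)] -/
theorem sum_fiber_branchSymbol_eq_neg_of_ap_zero (hf0 : IsNewform0 f) (hQ : coeffField f = ⊥)
    (hpN : ¬ p ∣ N) (hap : cuspCoeff f p = ((0 : ℤ) : ℂ)) {L L' : ℕ} (hL : L' = L + 1)
    (hdvd : p ^ L ∣ p ^ L') (a : ZMod (p ^ L)) :
    ∑ b ∈ Finset.univ.filter (fun b : ZMod (p ^ L') ↦ ZMod.castHom hdvd (ZMod (p ^ L)) b = a),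
        branchSymbol p f ((b.val : ℚ) / (p : ℚ) ^ L') =
      -branchSymbol p f (p * ((a.val : ℚ) / (p : ℚ) ^ L)) := by
  classical
  subst hL
  have hp : p.Prime := Fact.out
  haveI : NeZero p := ⟨hp.ne_zero⟩
  have hp0 : (p : ℚ) ≠ 0 := Nat.cast_ne_zero.mpr hp.ne_zero
  have hinj : Function.Injective
      (fun j : Fin p ↦ ((a.val + p ^ L * (j : ℕ) : ℕ) : ZMod (p ^ (L + 1)))) := by
    intro j j' h
    have hv := congr_arg ZMod.val h
    simp only [val_classLift] at hv
    exact Fin.ext (Nat.eq_of_mul_eq_mul_left (pow_pos hp.pos L) (by omega))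
  rw [filter_castHom_eq_image, Finset.sum_image fun j _ j' _ h ↦ hinj h]
  set x : ℚ := (a.val : ℚ) / (p : ℚ) ^ L with hx
  have hA : ∀ j : Fin p,
      ((a.val + p ^ L * (j : ℕ) : ℕ) : ℚ) / (p : ℚ) ^ (L + 1) = (x + j) / p := by
    intro j
    rw [hx]
    push_cast
    field_simp
    ring
  have hH := sum_range_branchSymbol_div_eq_neg hf0 hQ hpN hap x
  rw [← Fin.sum_univ_eq_sum_range (fun j ↦ branchSymbol p f ((x + j) / p)) p] at hH
  rw [← hH]
  refine Finset.sum_congr rfl fun j _ ↦ ?_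
  rw [val_classLift, hA]

/-- The fibre of `ℤ/p^{L+1} → ℤ/p^L` over any class has exactly `p` elements. [folklore] -/
private theorem card_filter_castHom_eq' {L L' : ℕ} (hL : L' = L + 1) (hdvd : p ^ L ∣ p ^ L')
    (a : ZMod (p ^ L)) :
    (Finset.univ.filter (fun b : ZMod (p ^ L') ↦ ZMod.castHom hdvd (ZMod (p ^ L)) b = a)).card
      = p := by
  classical
  subst hL
  have hp : p.Prime := Fact.out
  have hinj : Function.Injective
      (fun j : Fin p ↦ ((a.val + p ^ L * (j : ℕ) : ℕ) : ZMod (p ^ (L + 1)))) := by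
    intro j j' h
    have hv := congr_arg ZMod.val h
    simp only [val_classLift] at hv
    exact Fin.ext (Nat.eq_of_mul_eq_mul_left (pow_pos hp.pos L) (by omega))
  rw [filter_castHom_eq_image, Finset.card_image_of_injective _ hinj, Finset.card_univ,
    Fintype.card_fin]

/-- An orbit of `δ = γ^{p^{m}}` is a fibre (twin of the private lemma of the trivial-branch file).
[folklore] -/
private theorem image_mul_pow_eq_filter' {L L' : ℕ} (hL : L' = L + 1) (hdvd : p ^ L ∣ p ^ L')
    {b₀ δ : ZMod (p ^ L')} (hb₀ : IsUnit b₀) (hδ : orderOf δ = p)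
    (hδ1 : ZMod.castHom hdvd (ZMod (p ^ L)) δ = 1) :
    Finset.univ.image (fun j : Fin p ↦ b₀ * δ ^ (j : ℕ)) =
      Finset.univ.filter (fun b : ZMod (p ^ L') ↦
        ZMod.castHom hdvd (ZMod (p ^ L)) b = ZMod.castHom hdvd (ZMod (p ^ L)) b₀) := by
  classical
  have hinj : Function.Injective (fun j : Fin p ↦ b₀ * δ ^ (j : ℕ)) := by
    intro j j' h
    have h1 : δ ^ (j : ℕ) = δ ^ (j' : ℕ) := hb₀.mul_right_inj.mp h
    have h2 := pow_injOn_Iio_orderOf (x := δ) (by rw [hδ]; exact j.2) (by rw [hδ]; exact j'.2) h1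
    exact Fin.ext h2
  refine Finset.eq_of_subset_of_card_le (fun b hb ↦ ?_) ?_
  · obtain ⟨j, -, rfl⟩ := Finset.mem_image.mp hb
    simp only [Finset.mem_filter, Finset.mem_univ, true_and, map_mul, map_pow, hδ1, one_pow,
      mul_one]
  · rw [card_filter_castHom_eq' hL hdvd, Finset.card_image_of_injective _ hinj, Finset.card_univ,
      Fintype.card_fin]

/-- **Orbit form of the fibre sum** for the branch symbol:
`∑_{j<p} [b₀δ^j / p^{L+1}]^δ_f = −[p · (b₀ mod p^L)/p^L]^δ_f` (`a_p = 0`). [folklore] -/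
theorem sum_range_branchSymbol_orbit_eq_neg (hf0 : IsNewform0 f) (hQ : coeffField f = ⊥)
    (hpN : ¬ p ∣ N) (hap : cuspCoeff f p = ((0 : ℤ) : ℂ)) {L L' : ℕ} (hL : L' = L + 1)
    (hdvd : p ^ L ∣ p ^ L') {b₀ δ : ZMod (p ^ L')} (hb₀ : IsUnit b₀) (hδ : orderOf δ = p)
    (hδ1 : ZMod.castHom hdvd (ZMod (p ^ L)) δ = 1) :
    ∑ j ∈ Finset.range p, branchSymbol p f (((b₀ * δ ^ j).val : ℚ) / (p : ℚ) ^ L') =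
      -branchSymbol p f
        (p * (((ZMod.castHom hdvd (ZMod (p ^ L)) b₀).val : ℚ) / (p : ℚ) ^ L)) := by
  classical
  have hinj : Function.Injective (fun j : Fin p ↦ b₀ * δ ^ (j : ℕ)) := by
    intro j j' h
    have h1 : δ ^ (j : ℕ) = δ ^ (j' : ℕ) := hb₀.mul_right_inj.mp h
    have h2 := pow_injOn_Iio_orderOf (x := δ) (by rw [hδ]; exact j.2) (by rw [hδ]; exact j'.2) h1
    exact Fin.ext h2
  rw [← sum_fiber_branchSymbol_eq_neg_of_ap_zero hf0 hQ hpN hap hL hdvd,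
    ← image_mul_pow_eq_filter' hL hdvd hb₀ hδ hδ1, Finset.sum_image fun j _ j' _ h ↦ hinj h,
    ← Fin.sum_univ_eq_sum_range (fun j ↦ branchSymbol p f (((b₀ * δ ^ j).val : ℚ) / (p : ℚ) ^ L')) p]

/-- `[p · x/p^{S+1}]^δ_f = [(x mod p^S)/p^S]^δ_f`. [folklore] -/
theorem branchSymbol_mul_div_pow_eq {S I : ℕ} (hI : I = S + 1) (hdvd : p ^ S ∣ p ^ I)
    (x : ZMod (p ^ I)) :
    branchSymbol p f (p * ((x.val : ℚ) / (p : ℚ) ^ I)) =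
      branchSymbol p f (((ZMod.castHom hdvd (ZMod (p ^ S)) x).val : ℚ) / (p : ℚ) ^ S) := by
  subst hI
  have hp : p.Prime := Fact.out
  haveI : NeZero (p ^ S) := ⟨pow_ne_zero _ hp.ne_zero⟩
  have hp0 : (p : ℚ) ≠ 0 := Nat.cast_ne_zero.mpr hp.ne_zero
  have hval : (ZMod.castHom hdvd (ZMod (p ^ S)) x).val = x.val % p ^ S := by
    rw [ZMod.castHom_apply, ZMod.cast_eq_val, ZMod.val_natCast]
  set q : ℕ := x.val / p ^ S with hq
  set r : ℕ := x.val % p ^ S with hr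
  have hx : (x.val : ℚ) = (r : ℚ) + (p : ℚ) ^ S * (q : ℚ) := by
    rw [hr, hq]
    exact_mod_cast (Nat.mod_add_div x.val (p ^ S)).symm
  have heq : (p : ℚ) * ((x.val : ℚ) / (p : ℚ) ^ (S + 1)) =
      (r : ℚ) / (p : ℚ) ^ S + ((q : ℤ) : ℚ) := by
    rw [hx, Int.cast_natCast, pow_succ]
    field_simp
  rw [heq, branchSymbol_add_intCast, hval]

end Symbol

end Summit.BirchSwinnertonDyer.Rank1Residual.Additive

end
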